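import Literature.Barriers.CriticalPhenomena.KozmaNitzanDirectedCounterexample
import HarnessLib

/-!
# `AdditiveGluing` (stmt-CriticalPhenomena-4576) — its DIRECTED analogue is FALSE
# (Kozma–Nitzan's Figure-4 digraph at forward weight `3/4`)

Support / proof-shape file (literature seat `prim-cplus-literature` gen 28; to be landed by a prover as
`--supports stmt-CriticalPhenomena-4576`).  No named facts, no sorries, no conjectures.  Memo:
`run/shared/lean/prim/prim-cplus-literature/DIRECTED-ANALOGUES.md`.

The crux `AdditiveGluing` reads: for every finite weighted graph, relays `A`, vertices `o, b` and `t ≥ 0`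
with `1 − t ≤ P(a ↔ b)` for all `a ∈ A`, one has `P(o ↔ A) − t ≤ P(o ↔ b)`.  Replace the graph by a
finite DIGRAPH with independent arcs (arcs `Fin m`, endpoints `src tgt : Fin m → Fin n`, weights `w`, law
`prodBernoulli w`) and `↔` by directed connection `→`
(`Literature.Barriers.CriticalPhenomena.DirectedPercolation.openDConn`, the vocabulary of the barrier file
`KozmaNitzanDirectedCounterexample.lean`, Kozma–Nitzan 2024 §5.7).  The resulting statement is FALSE:
on Kozma–Nitzan's Figure-4 digraph (`0 → aᵢ`, `aᵢ → b` random, SURE back arcs `aᵢ → 0`) with forward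
weight `3/4` (the paper's weight `1/2` refutes the multiplicative Conjecture 1 but satisfies the additive
form, `7/16 ≥ 3/4 − 3/8`):

  `P(0 → b) = 207/256`,  `P(0 → A) = 15/16`,  `P(aᵢ → b) = 57/64`, and with `t = 7/64`:
  `P(0 → A) − t = 212/256 > 207/256 = P(0 → b)`.

CONSEQUENCE (proof shape): an argument for `AdditiveGluing` that uses only direction-blind structure
(independence, monotonicity/Harris, reflexivity + transitivity of connection, exploration from `o`) would
prove the directed statement refuted here; every proof must use the symmetry of `↔` — already for `|A| = 2`.

* `DirectedAdditiveCex.w34` — the Figure-4 arcs with forward weight `3/4` (event identities of the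
  barrier file are weight-free and are reused verbatim).
* `DirectedAdditiveCex.real_zero_b / real_zero_relays / real_relay_b` — `207/256`, `15/16`, `57/64`.
* `not_directedAdditiveGluing` — the negation of the directed analogue of `AdditiveGluing`, in the typed
  shape of the crux (`0 ≤ t → (∀ a ∈ A, 1 − t ≤ P(a → b)) → P(o → A) − t ≤ P(o → b)`).
-/

noncomputable section

namespace Summit.CriticalPhenomena.PercolationContinuityZ3.Theorems

open MeasureTheory Set Literature.Probability.LatticeModels
open Literature.Barriers.CriticalPhenomena Literature.Barriers.CriticalPhenomena.DirectedPercolation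
open Literature.Barriers.CriticalPhenomena.KozmaNitzanDirected

namespace DirectedAdditiveCex

/-- `3/4` as a point of `[0,1]`. -/
def threeQuarters : unitInterval := ⟨3 / 4, by norm_num, by norm_num⟩

/-- Figure-4 arcs with forward weight `3/4` (`e₀ : 0 → a₁`, `e₁ : 0 → a₂`, `e₂ : a₁ → b`, `e₃ : a₂ → b`)
and sure back arcs `e₄ : a₁ → 0`, `e₅ : a₂ → 0`. -/
def w34 : Fin 6 → unitInterval := ![threeQuarters, threeQuarters, threeQuarters, threeQuarters, 1, 1]

/-- The six weights of `w34`, coordinatewise. [folklore] -/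
@[simp] private theorem w34_vals :
    (w34 0 : ℝ) = 3 / 4 ∧ (w34 1 : ℝ) = 3 / 4 ∧ (w34 2 : ℝ) = 3 / 4 ∧ (w34 3 : ℝ) = 3 / 4 ∧
      (w34 4 : ℝ) = 1 ∧ (w34 5 : ℝ) = 1 :=
  ⟨rfl, rfl, rfl, rfl, rfl, rfl⟩

/-- A two-arc cylinder as a set. [folklore] -/
private theorem setOf_mem_and_mem (i j : Fin 6) :
    {ω : Set (Fin 6) | i ∈ ω ∧ j ∈ ω} = {ω | (↑({i, j} : Finset (Fin 6)) : Set (Fin 6)) ⊆ ω} := by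
  ext ω; simp [Set.insert_subset_iff]

/-- A one-arc cylinder as a set. [folklore] -/
private theorem setOf_mem₁ (i : Fin 6) :
    {ω : Set (Fin 6) | i ∈ ω} = {ω | (↑({i} : Finset (Fin 6)) : Set (Fin 6)) ⊆ ω} := by
  ext ω; simp

/-- A three-arc cylinder as a set. [folklore] -/
private theorem setOf_mem₃ (i j k : Fin 6) :
    {ω : Set (Fin 6) | i ∈ ω ∧ j ∈ ω ∧ k ∈ ω} = {ω | (↑({i, j, k} : Finset (Fin 6)) : Set (Fin 6)) ⊆ ω} := by
  ext ω; simp [Set.insert_subset_iff]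

/-- Intersection of two open-arc cylinders. [folklore] -/
private theorem cyl_inter (F G : Finset (Fin 6)) :
    {ω : Set (Fin 6) | (↑F : Set (Fin 6)) ⊆ ω} ∩ {ω | (↑G : Set (Fin 6)) ⊆ ω} =
      {ω | (↑(F ∪ G) : Set (Fin 6)) ⊆ ω} := by
  ext ω; simp [Set.union_subset_iff]

/-- Inclusion–exclusion for two cylinders under `prodBernoulli w34`. -/
private theorem real_cyl_union (F G : Finset (Fin 6)) :
    (prodBernoulli w34).real ({ω : Set (Fin 6) | (↑F : Set (Fin 6)) ⊆ ω} ∪ {ω | (↑G : Set (Fin 6)) ⊆ ω}) =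
      (∏ i ∈ F, (w34 i : ℝ)) + (∏ i ∈ G, (w34 i : ℝ)) - ∏ i ∈ F ∪ G, (w34 i : ℝ) := by
  have h := measureReal_union_add_inter₀ (μ := prodBernoulli w34)
    (s := {ω : Set (Fin 6) | (↑F : Set (Fin 6)) ⊆ ω}) (t := {ω | (↑G : Set (Fin 6)) ⊆ ω})
    MeasurableSet.of_discrete.nullMeasurableSet
  rw [cyl_inter, prodBernoulli_real_subset, prodBernoulli_real_subset, prodBernoulli_real_subset] at h
  linarith

/-- `P(0 → b) = 207/256` at forward weight `3/4`. -/
theorem real_zero_b : (prodBernoulli w34).real (openDConn src tgt (0 : Fin 4) 3) = 207 / 256 := by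
  rw [openDConn_zero_b, setOf_mem_and_mem, setOf_mem_and_mem, real_cyl_union]
  simp [Finset.prod_insert, Finset.prod_singleton]
  norm_num

/-- `P(0 → A) = 15/16` at forward weight `3/4`. -/
theorem real_zero_relays :
    (prodBernoulli w34).real (⋃ a ∈ relays, openDConn src tgt (0 : Fin 4) a) = 15 / 16 := by
  rw [iUnion_openDConn_zero_relays, setOf_mem₁, setOf_mem₁, real_cyl_union]
  simp [Finset.prod_insert, Finset.prod_singleton]
  norm_num

/-- `P(a₁ → b) = 57/64` at forward weight `3/4`. -/
theorem real_a₁_b : (prodBernoulli w34).real (openDConn src tgt (1 : Fin 4) 3) = 57 / 64 := by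
  rw [openDConn_a₁_b, setOf_mem₁, setOf_mem₃, real_cyl_union]
  simp [Finset.prod_insert, Finset.prod_singleton]
  norm_num

/-- `P(a₂ → b) = 57/64` at forward weight `3/4`. -/
theorem real_a₂_b : (prodBernoulli w34).real (openDConn src tgt (2 : Fin 4) 3) = 57 / 64 := by
  rw [openDConn_a₂_b, setOf_mem₁, setOf_mem₃, real_cyl_union]
  simp [Finset.prod_insert, Finset.prod_singleton]
  norm_num

/-- `P(a → b) = 57/64` for both relays. -/
theorem real_relay_b {a : Fin 4} (ha : a ∈ relays) :
    (prodBernoulli w34).real (openDConn src tgt a 3) = 57 / 64 := by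
  simp only [relays, Finset.mem_insert, Finset.mem_singleton] at ha
  rcases ha with rfl | rfl
  · exact real_a₁_b
  · exact real_a₂_b

/-- The additive gluing inequality fails on the example: `P(0 → b) < P(0 → A) − max_a P(a ↛ b)`
(`207/256 < 240/256 − 28/256`). -/
theorem additive_fails :
    (prodBernoulli w34).real (openDConn src tgt (0 : Fin 4) 3) <
      (prodBernoulli w34).real (⋃ a ∈ relays, openDConn src tgt (0 : Fin 4) a) - 7 / 64 := by
  rw [real_zero_b, real_zero_relays]
  norm_num

end DirectedAdditiveCex

/-- **The directed analogue of `AdditiveGluing` is false.**  In the typed shape of the crux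
(stmt-CriticalPhenomena-4576) with a finite digraph (`Fin m` arcs on `Fin n`, endpoints `src, tgt`,
independent arcs of weights `w`) and directed connection in place of `↔`:
NOT (for all such data and `t ≥ 0`, `(∀ a ∈ A, 1 − t ≤ P(a → b)) → P(o → A) − t ≤ P(o → b)`).
Witness: Kozma–Nitzan's Figure-4 digraph with forward weight `3/4`, `A = {a₁, a₂}`, `t = 7/64`. -/
theorem not_directedAdditiveGluing :
    ¬ ∀ (n m : ℕ) (src tgt : Fin m → Fin n) (w : Fin m → unitInterval) (A : Finset (Fin n))
        (o b : Fin n) (t : ℝ), 0 ≤ t →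
        (∀ a ∈ A, 1 - t ≤ (prodBernoulli w).real (openDConn src tgt a b)) →
          (prodBernoulli w).real (⋃ a ∈ A, openDConn src tgt o a) - t ≤
            (prodBernoulli w).real (openDConn src tgt o b) := by
  intro h
  have key := h 4 6 KozmaNitzanDirected.src KozmaNitzanDirected.tgt DirectedAdditiveCex.w34
    KozmaNitzanDirected.relays 0 3 (7 / 64) (by norm_num)
    (fun a ha => by rw [DirectedAdditiveCex.real_relay_b ha]; norm_num)
  exact absurd key (not_le.2 DirectedAdditiveCex.additive_fails)

end Summit.CriticalPhenomena.PercolationContinuityZ3.Theorems
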